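import Mathlib
import Literature.NumberTheory.Sieve.BatemanHorn
import Literature.NumberTheory.Sieve.BatemanHornProofs
import Literature.NumberTheory.Sieve.PolynomialValuesSieveSequence
import HarnessLib

/-!
# Crux `SystemMomentDeficit` (stmt-Parity-11326), line `Ideator3Sketch`: `stub_crtPairCount`

Stub S1 (CRT pair count) of the line skeleton
`Summit.Parity.BatemanHorn.Cruxes.SystemMomentDeficit.Ideator3Sketch` for the crux
`Summit.Parity.BatemanHorn.Theses.AlmostPrimeZeros.SystemMomentDeficit`.

For `g₁, g₂ ∈ ℤ[X]`, coprime moduli `q₁, q₂ ≥ 1` and any `N`, the number of `n ∈ [0, N)` with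
`q₁ ∣ g₁(n)` and `q₂ ∣ g₂(n)` lies between `ρ_{g₁}(q₁) ρ_{g₂}(q₂) ⌊N/(q₁q₂)⌋` and
`ρ_{g₁}(q₁) ρ_{g₂}(q₂) (⌊N/(q₁q₂)⌋ + 1)`, where `ρ_g(q) = polyRootCountMod ![g] q` is the number of
roots of `g` modulo `q` (`Literature.NumberTheory.Sieve.polyRootCountMod_single`).

Proof: partition `{n < N : q₁ ∣ g₁(n), q₂ ∣ g₂(n)}` by the residue of `n` modulo `q₁`
(`Literature.NumberTheory.Sieve.card_filter_dvd_eval_eq_sum` with `S = {n < N : q₂ ∣ g₂(n)}`),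
then each fibre by the residue modulo `q₂` (same lemma with `S = {n < N : n ≡ s (mod q₁)}`); a
pair of classes `(s mod q₁, t mod q₂)` is one class `c mod q₁q₂` (`Nat.chineseRemainder`,
`Nat.modEq_and_modEq_iff_modEq_mul`), which has `⌊N/(q₁q₂)⌋ + [c % (q₁q₂) < N % (q₁q₂)]`
representatives below `N` (`Nat.count_modEq_card`).  Everything is [folklore]; no definitions are
introduced.
-/

namespace Summit.Parity.BatemanHorn.Cruxes.SystemMomentDeficit.Ideator3Sketch

open Finset Polynomial
open Literature.NumberTheory.Sieve

/-- One CRT class: for coprime `q₁, q₂ ≥ 1` and residues `s, t`,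
`⌊N/(q₁q₂)⌋ ≤ #{n < N : n ≡ s (mod q₁), n ≡ t (mod q₂)} ≤ ⌊N/(q₁q₂)⌋ + 1`
(the two congruences form one class modulo `q₁q₂`, `Nat.chineseRemainder`). [folklore] -/
private theorem card_range_filter_modEq_and_modEq {q₁ q₂ : ℕ} (hq₁ : 0 < q₁) (hq₂ : 0 < q₂)
    (hq : Nat.Coprime q₁ q₂) (N s t : ℕ) :
    N / (q₁ * q₂) ≤ #((range N).filter fun n : ℕ => n ≡ s [MOD q₁] ∧ n ≡ t [MOD q₂]) ∧
      #((range N).filter fun n : ℕ => n ≡ s [MOD q₁] ∧ n ≡ t [MOD q₂]) ≤ N / (q₁ * q₂) + 1 := by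
  obtain ⟨c, hcs, hct⟩ := Nat.chineseRemainder hq s t
  have hset : ((range N).filter fun n : ℕ => n ≡ s [MOD q₁] ∧ n ≡ t [MOD q₂]) =
      (range N).filter fun n : ℕ => n ≡ c [MOD q₁ * q₂] := by
    refine Finset.filter_congr fun n _ => ?_
    rw [← Nat.modEq_and_modEq_iff_modEq_mul hq]
    constructor
    · rintro ⟨h1, h2⟩
      exact ⟨h1.trans hcs.symm, h2.trans hct.symm⟩
    · rintro ⟨h1, h2⟩
      exact ⟨h1.trans hcs, h2.trans hct⟩
  rw [hset, ← Nat.count_eq_card_filter_range, Nat.count_modEq_card N (Nat.mul_pos hq₁ hq₂) (c : ℕ)]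
  constructor <;> split_ifs <;> omega

/-- Double partition by residues: for `q₁, q₂ ≥ 1`,
`#{n < N : q₁ ∣ g₁(n), q₂ ∣ g₂(n)} = Σ_{s < q₁, q₁ ∣ g₁(s)} Σ_{t < q₂, q₂ ∣ g₂(t)} #{n < N : n ≡ s (mod q₁), n ≡ t (mod q₂)}`
(divisibility `q ∣ g(n)` only depends on `n mod q`; two applications of
`Literature.NumberTheory.Sieve.card_filter_dvd_eval_eq_sum`). [folklore] -/
private theorem card_range_filter_dvd_eval_and_eq_sum_sum (g₁ g₂ : ℤ[X]) {q₁ q₂ : ℕ}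
    (hq₁ : 0 < q₁) (hq₂ : 0 < q₂) (N : ℕ) :
    #((range N).filter fun n : ℕ => (q₁ : ℤ) ∣ g₁.eval (n : ℤ) ∧ (q₂ : ℤ) ∣ g₂.eval (n : ℤ)) =
      ∑ s ∈ (range q₁).filter (fun s : ℕ => (q₁ : ℤ) ∣ g₁.eval (s : ℤ)),
        ∑ t ∈ (range q₂).filter (fun t : ℕ => (q₂ : ℤ) ∣ g₂.eval (t : ℤ)),
          #((range N).filter fun n : ℕ => n ≡ s [MOD q₁] ∧ n ≡ t [MOD q₂]) := by
  have h1 : ((range N).filter fun n : ℕ =>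
        (q₁ : ℤ) ∣ g₁.eval (n : ℤ) ∧ (q₂ : ℤ) ∣ g₂.eval (n : ℤ)) =
      ((range N).filter fun n : ℕ => (q₂ : ℤ) ∣ g₂.eval (n : ℤ)).filter
        fun n : ℕ => (q₁ : ℤ) ∣ g₁.eval (n : ℤ) := by
    rw [Finset.filter_filter]
    exact Finset.filter_congr fun n _ => and_comm
  rw [h1, card_filter_dvd_eval_eq_sum g₁ _ hq₁]
  refine Finset.sum_congr rfl fun s _ => ?_
  have h2 : (((range N).filter fun n : ℕ => (q₂ : ℤ) ∣ g₂.eval (n : ℤ)).filter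
        fun n : ℕ => n ≡ s [MOD q₁]) =
      ((range N).filter fun n : ℕ => n ≡ s [MOD q₁]).filter
        fun n : ℕ => (q₂ : ℤ) ∣ g₂.eval (n : ℤ) := by
    rw [Finset.filter_filter, Finset.filter_filter]
    exact Finset.filter_congr fun n _ => and_comm
  rw [h2, card_filter_dvd_eval_eq_sum g₂ _ hq₂]
  refine Finset.sum_congr rfl fun t _ => ?_
  rw [Finset.filter_filter]

/-- **Stub S1 (CRT pair count).** For `g₁, g₂ ∈ ℤ[X]`, coprime moduli `q₁, q₂ ≥ 1` and any `N`:
in `[0, N)` the number of `n` with `q₁ ∣ g₁(n)` and `q₂ ∣ g₂(n)` lies between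
`ρ_{g₁}(q₁) ρ_{g₂}(q₂) ⌊N/(q₁q₂)⌋` and `ρ_{g₁}(q₁) ρ_{g₂}(q₂) (⌊N/(q₁q₂)⌋ + 1)`
(`ρ_g(q) = polyRootCountMod ![g] q`; the admissible residues mod `q₁q₂` are the CRT pairs of roots,
each class having `⌊N/(q₁q₂)⌋` or `⌊N/(q₁q₂)⌋ + 1` representatives below `N`). [folklore] -/
theorem stub_crtPairCount :
    ∀ (g₁ g₂ : ℤ[X]) (q₁ q₂ N : ℕ), 0 < q₁ → 0 < q₂ → Nat.Coprime q₁ q₂ →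
      polyRootCountMod ![g₁] q₁ * polyRootCountMod ![g₂] q₂ * (N / (q₁ * q₂)) ≤
          #((Finset.range N).filter fun n : ℕ =>
            (q₁ : ℤ) ∣ g₁.eval (n : ℤ) ∧ (q₂ : ℤ) ∣ g₂.eval (n : ℤ)) ∧
        #((Finset.range N).filter fun n : ℕ =>
            (q₁ : ℤ) ∣ g₁.eval (n : ℤ) ∧ (q₂ : ℤ) ∣ g₂.eval (n : ℤ)) ≤
          polyRootCountMod ![g₁] q₁ * polyRootCountMod ![g₂] q₂ * (N / (q₁ * q₂) + 1) := by
  intro g₁ g₂ q₁ q₂ N hq₁ hq₂ hq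
  rw [card_range_filter_dvd_eval_and_eq_sum_sum g₁ g₂ hq₁ hq₂ N, polyRootCountMod_single,
    polyRootCountMod_single]
  constructor
  · calc #((range q₁).filter fun n : ℕ => (q₁ : ℤ) ∣ g₁.eval (n : ℤ)) *
          #((range q₂).filter fun n : ℕ => (q₂ : ℤ) ∣ g₂.eval (n : ℤ)) * (N / (q₁ * q₂))
        = ∑ _s ∈ (range q₁).filter (fun s : ℕ => (q₁ : ℤ) ∣ g₁.eval (s : ℤ)),
            ∑ _t ∈ (range q₂).filter (fun t : ℕ => (q₂ : ℤ) ∣ g₂.eval (t : ℤ)),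
              N / (q₁ * q₂) := by
          rw [Finset.sum_const, Finset.sum_const, smul_eq_mul, smul_eq_mul, mul_assoc]
      _ ≤ _ := Finset.sum_le_sum fun s _ => Finset.sum_le_sum fun t _ =>
          (card_range_filter_modEq_and_modEq hq₁ hq₂ hq N s t).1
  · calc _ ≤ ∑ _s ∈ (range q₁).filter (fun s : ℕ => (q₁ : ℤ) ∣ g₁.eval (s : ℤ)),
            ∑ _t ∈ (range q₂).filter (fun t : ℕ => (q₂ : ℤ) ∣ g₂.eval (t : ℤ)),
              (N / (q₁ * q₂) + 1) :=
          Finset.sum_le_sum fun s _ => Finset.sum_le_sum fun t _ =>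
            (card_range_filter_modEq_and_modEq hq₁ hq₂ hq N s t).2
      _ = _ := by
          rw [Finset.sum_const, Finset.sum_const, smul_eq_mul, smul_eq_mul, mul_assoc]

end Summit.Parity.BatemanHorn.Cruxes.SystemMomentDeficit.Ideator3Sketch
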